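import Summits.Ventures.QEC.Census.CertBZPlane
import Summits.Ventures.QEC.Census.TwoBGA.A2h_n294_k22_874fd3d2.Cert
import Summits.Ventures.QEC.Census.TwoBGA.A2h_n294_k22_874fd3d2.OrbitZ
import Summits.Ventures.QEC.Census.TwoBGA.A2h_n294_k22_874fd3d2.OrbitX
import HarnessLib

/-!
# `A2h_n294_k22_874fd3d2` — lane-engine replays, part 10/10 (census row `A2h_n294_k22_874fd3d2`; qec-search-4 g4 orbit lane)

`Plane.segOK` verdicts (type-01 lane engine, `decide +kernel`) for segments of the kernel-basis replays of the views of
`Census/TwoBGA/A2h_n294_k22_874fd3d2/`; assembled in `Distance.lean`.  Generated by `tools/gen4/emit_orbit_row.py`; do not edit by hand.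
-/

set_option autoImplicit false
set_option Elab.async false

namespace Summit.Ventures.QEC.Census.A2h_n294_k22_874fd3d2

open Summit.Ventures.QEC.Census

set_option maxHeartbeats 400000000 in
/-- `X` view 0, lane segment `[151, 152)` (573952 lanes, depth 4, threshold 9; est 8 s): every selection with largest row there passes (lane engine, KERNEL). -/
theorem psegX_0_53 : Plane.segOK 294 9 (A2h_n294_k22_874fd3d2.cert.sideX.found.map Prod.fst) A2h_n294_k22_874fd3d2.pGX_0 4 151 1 6 = true := by
  decide +kernel

set_option maxHeartbeats 400000000 in
/-- `X` view 0, lane segment `[152, 153)` (585429 lanes, depth 4, threshold 9; est 8 s): every selection with largest row there passes (lane engine, KERNEL). -/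
theorem psegX_0_54 : Plane.segOK 294 9 (A2h_n294_k22_874fd3d2.cert.sideX.found.map Prod.fst) A2h_n294_k22_874fd3d2.pGX_0 4 152 1 6 = true := by
  decide +kernel

set_option maxHeartbeats 400000000 in
/-- `X` view 0, lane segment `[153, 154)` (597058 lanes, depth 4, threshold 9; est 8 s): every selection with largest row there passes (lane engine, KERNEL). -/
theorem psegX_0_55 : Plane.segOK 294 9 (A2h_n294_k22_874fd3d2.cert.sideX.found.map Prod.fst) A2h_n294_k22_874fd3d2.pGX_0 4 153 1 6 = true := by
  decide +kernel

set_option maxHeartbeats 400000000 in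
/-- `X` view 0, lane segment `[154, 155)` (608840 lanes, depth 4, threshold 9; est 9 s): every selection with largest row there passes (lane engine, KERNEL). -/
theorem psegX_0_56 : Plane.segOK 294 9 (A2h_n294_k22_874fd3d2.cert.sideX.found.map Prod.fst) A2h_n294_k22_874fd3d2.pGX_0 4 154 1 6 = true := by
  decide +kernel

set_option maxHeartbeats 400000000 in
/-- `X` view 0, lane segment `[155, 156)` (620776 lanes, depth 4, threshold 9; est 9 s): every selection with largest row there passes (lane engine, KERNEL). -/
theorem psegX_0_57 : Plane.segOK 294 9 (A2h_n294_k22_874fd3d2.cert.sideX.found.map Prod.fst) A2h_n294_k22_874fd3d2.pGX_0 4 155 1 6 = true := by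
  decide +kernel

set_option maxHeartbeats 400000000 in
/-- `X` view 0, lane segment `[156, 157)` (632867 lanes, depth 4, threshold 9; est 9 s): every selection with largest row there passes (lane engine, KERNEL). -/
theorem psegX_0_58 : Plane.segOK 294 9 (A2h_n294_k22_874fd3d2.cert.sideX.found.map Prod.fst) A2h_n294_k22_874fd3d2.pGX_0 4 156 1 6 = true := by
  decide +kernel

set_option maxHeartbeats 400000000 in
/-- `X` view 0, lane segment `[157, 158)` (645114 lanes, depth 4, threshold 9; est 9 s): every selection with largest row there passes (lane engine, KERNEL). -/
theorem psegX_0_59 : Plane.segOK 294 9 (A2h_n294_k22_874fd3d2.cert.sideX.found.map Prod.fst) A2h_n294_k22_874fd3d2.pGX_0 4 157 1 6 = true := by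
  decide +kernel

end Summit.Ventures.QEC.Census.A2h_n294_k22_874fd3d2
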